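import Mathlib
import Literature.NumberTheory.DiophantineGeometry.FunctionFieldDerivations
import Literature.LinearAlgebra.Matrix.WronskianDerivation
import HarnessLib

/-!
# The `S`-unit equation over function fields: the Wronskian argument (Zannier 1993, Theorem 1,
  case `μ = n`)

Sibling proof file of `FunctionFieldUnitEquation.lean` (the named facts `Zannier1993_thm1`,
`Zannier1993_cor`). Here: the first half of the printed proof of **Theorem 1** of U. Zannier, *Some
remarks on the `S`-unit equation in function fields*, Acta Arith. 64 (1993) 87–98, pp. 89–90 — the case
`μ = n` (the `aᵢ` linearly independent over `k`), "following [3]" (Brownawell–Masser):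

* **Lemma 1** (= Lemma 2 of Brownawell–Masser 1986) in the two cases used, for the derivation
  `d/dt_v` with respect to a local parameter: `v(W_{t_v}(f)) ≥ Σ v(fᵢ) − C(n,2)` for non-zero `fᵢ`
  (`wronskian_tderiv_uniformizer_mem_ball`, `ν = 0`) and `W_{t_v}(f) ∈ 𝒪_v` for `v`-integral `fᵢ`
  (`wronskian_tderiv_uniformizer_mem`, `ν = n`), from `v(dʲf/dt_vʲ) ≥ v(f) − j` and the permutation
  expansion of the determinant (`PlaceOver.det_mem_ball`); and the change of variable
  `W_z(f) = (dt_v/dz)^{C(n,2)} W_{t_v}(f)` with `v(dt_v/dz) = −v(dz/dt_v) = −diffOrd_v(z)`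
  (`wronskian_tderiv_eq`, `ord_wronskian_tderiv`), which turns these into the printed
  `v(W) ≥ −C(n,2) v(dz/dt_v) − (C(n,2) − C(ν,2)) + Σ v(fᵢ)`;
* the case `μ = n` of Theorem 1 (`Zannier1993_sum_le_of_linearIndependent`): for `a₁, …, aₙ`
  linearly independent `S`-units and `b = a₁ + … + aₙ`,
  `Σ_{v∈S} (v(b) − min v(aᵢ)) ≤ C(n,2)(#S + 2g − 2)` — (5) `W(a₁,…,aₙ) = W(a₁,…,b,…,aₙ)`
  (`wronskian_update_sum`), (6) summing Lemma 1 (`ν = 0`) over `S` with `Σ_{v∈S} v(aᵢ) = 0`,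
  (7) Lemma 1 (`ν = n`) off `S`, (8) `Σ_v v(W) = 0` (`degree_principalDivisor_eq_zero`) and
  `Σ_v v(dz/dt_v) = 2g − 2` (`finsum_diffOrd_eq`, Riemann–Hurwitz).

Stated over the tree's interface with `K` the full constant field, characteristic `0` and all places
rational (`hrat`), which is the situation of an algebraically closed `k` of characteristic `0`
(`PlaceOver.isRational_of_isAlgClosed`, `isIntegrallyClosedIn_of_isAlgClosed`). The general case of
Theorem 1 (Zannier's induction, pp. 90–92) and the discharges are in `FunctionFieldUnitEquationProofs`.
Everything is proved; no named facts.

## References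

* U. Zannier, Acta Arith. 64 (1993) 87–98, proof of Theorem 1, pp. 89–90, (5)–(8), Lemma 1. [Zannier1993]
* R. C. Mason, *Diophantine Equations over Function Fields*, LMS LNS 96 (1984), Ch. I §2 (6). [Mason1984]
* H. Stichtenoth, *Algebraic Function Fields and Codes*, GTM 254 (2009), Thm. 1.4.11, Cor. 3.4.14. [Stichtenoth2009]
-/

noncomputable section

open scoped Classical
open _root_.Literature.LinearAlgebra.Matrix

namespace Literature.NumberTheory.DiophantineGeometry.AlgFunctionField

universe u v

variable {K : Type u} {F : Type v} [Field K] [Field F] [Algebra K F]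

/-! ### Balls `t_Pᵐ𝒪_P`: products and determinants -/

section balls

namespace PlaceOver

/-- `t_Pᵖ𝒪_P · t_P^q𝒪_P ⊆ t_P^{p+q}𝒪_P`. [folklore] -/
theorem mul_mem_ball_add (P : PlaceOver K F) {p q : ℤ} {x y : F} (hx : x ∈ P.ball p)
    (hy : y ∈ P.ball q) : x * y ∈ P.ball (p + q) := by
  rw [PlaceOver.mem_ball_iff] at hx hy ⊢
  rw [Valuation.map_mul, zpow_add₀ P.valuation_uniformizer_ne_zero]
  exact mul_le_mul' hx hy

/-- `1 ∈ 𝒪_P = t_P⁰𝒪_P`. [folklore] -/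
theorem one_mem_ball_zero (P : PlaceOver K F) : (1 : F) ∈ P.ball 0 :=
  (P.mem_ball_zero_iff 1).2 (one_mem _)

/-- Finite products: `gᵢ ∈ t_P^{eᵢ}𝒪_P ⇒ Π gᵢ ∈ t_P^{Σ eᵢ}𝒪_P`. [folklore] -/
theorem prod_mem_ball (P : PlaceOver K F) {ι : Type*} (s : Finset ι) (g : ι → F) (e : ι → ℤ)
    (h : ∀ i ∈ s, g i ∈ P.ball (e i)) : ∏ i ∈ s, g i ∈ P.ball (∑ i ∈ s, e i) := by
  induction s using Finset.induction_on with
  | empty => simpa using P.one_mem_ball_zero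
  | insert i s hi ih =>
    rw [Finset.prod_insert hi, Finset.sum_insert hi]
    exact P.mul_mem_ball_add (h i (Finset.mem_insert_self i s))
      (ih fun j hj ↦ h j (Finset.mem_insert_of_mem hj))

/-- **Permutation expansion bound**: if the `(i, j)` entry of a square matrix lies in
`t_P^{e_j − i}𝒪_P` (row `i` = order of derivative, column `j` = function of order bound `e_j`), then
its determinant lies in `t_P^{Σ e_j − n(n−1)/2}𝒪_P` (each product `Π_i M_{σ(i), i}` has order
`≥ Σ e_i − Σ σ(i) = Σ e_i − C(n,2)`; Zannier 1993 Lemma 1 / Brownawell–Masser Lemma 2, `ν = 0`).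
[cite: Zannier1993, Lemma 1] -/
theorem det_mem_ball (P : PlaceOver K F) {n : ℕ} (M : Matrix (Fin n) (Fin n) F) (e : Fin n → ℤ)
    (h : ∀ i j : Fin n, M i j ∈ P.ball (e j - ((i : ℕ) : ℤ))) :
    M.det ∈ P.ball (∑ j, e j - n.choose 2) := by
  rw [Matrix.det_apply]
  refine Submodule.sum_mem _ fun σ _ ↦ ?_
  rw [Units.smul_def]
  refine zsmul_mem ?_ _
  have hprod := P.prod_mem_ball Finset.univ (fun i ↦ M (σ i) i) (fun i ↦ e i - ((σ i : ℕ) : ℤ))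
    fun i _ ↦ h (σ i) i
  have hsum : ∑ i : Fin n, (e i - ((σ i : ℕ) : ℤ)) = ∑ j, e j - n.choose 2 := by
    rw [Finset.sum_sub_distrib, Equiv.sum_comp σ (fun i : Fin n ↦ ((i : ℕ) : ℤ)),
      Fin.sum_univ_eq_sum_range (fun i ↦ ((i : ℕ) : ℤ)) n, ← Nat.cast_sum, Finset.sum_range_id,
      Nat.choose_two_right]
  rw [hsum] at hprod
  exact hprod

/-- A determinant with `P`-integral entries is `P`-integral. [folklore] -/
theorem det_mem_toValuationSubring (P : PlaceOver K F) {n : Type*} [Fintype n] [DecidableEq n]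
    (M : Matrix n n F) (h : ∀ i j, M i j ∈ P.toValuationSubring) : M.det ∈ P.toValuationSubring :=
  det_mem_of_forall_mem P.toValuationSubring.toSubring M h

end PlaceOver

end balls

/-! ### Wronskians with respect to `d/dt_P` and `d/dz` (Zannier's Lemma 1) -/

section wronskians

variable [IsAlgFunctionField K F] [IsIntegrallyClosedIn K F] [CharZero K]

/-- **Lemma 1, `ν = n`** (all `f_j` integral at `P`): `W_{t_P}(f₁, …, fₙ) ∈ 𝒪_P`, since `d/dt_P`
preserves `𝒪_P`. [cite: Zannier1993, Lemma 1] -/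
theorem wronskian_tderiv_uniformizer_mem (hrat : ∀ P : PlaceOver K F, P.IsRational)
    (P : PlaceOver K F) {n : ℕ} (f : Fin n → F) (hf : ∀ j, f j ∈ P.toValuationSubring) :
    wronskian (tderiv K (P.uniformizer : F)) f ∈ P.toValuationSubring :=
  P.det_mem_toValuationSubring _ fun i j ↦ iterate_tderiv_uniformizer_mem hrat P (hf j) i

/-- `dʲy/dt_Pʲ ∈ t_P^{v_P(y) − j}𝒪_P` (Mason 1984 Ch. I §2 (6), iterated; for `y = 0` or a vanishing
derivative the junk value `v_P(0) = 0` is harmless). [cite: Mason1984, Ch. I §2 (6)] -/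
theorem iterate_tderiv_uniformizer_mem_ball (hrat : ∀ P : PlaceOver K F, P.IsRational)
    (P : PlaceOver K F) (y : F) (j : ℕ) :
    (tderiv K (P.uniformizer : F))^[j] y ∈ P.ball (P.ord y - j) := by
  by_cases h0 : (tderiv K (P.uniformizer : F))^[j] y = 0
  · rw [h0]
    exact zero_mem _
  · exact (P.mem_ball_iff_le_ord _ h0).2 (ord_sub_le_ord_iterate_tderiv_uniformizer hrat P y j)

/-- **Lemma 1, `ν = 0`**: `v_P(W_{t_P}(f₁, …, fₙ)) ≥ Σ v_P(f_j) − C(n,2)`, in the form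
`W_{t_P}(f) ∈ t_P^{Σ v_P(f_j) − C(n,2)}𝒪_P` (which also covers `W = 0`; for a zero `f_j` the junk value
`v_P(0) = 0` is used and the Wronskian vanishes). [cite: Zannier1993, Lemma 1] -/
theorem wronskian_tderiv_uniformizer_mem_ball (hrat : ∀ P : PlaceOver K F, P.IsRational)
    (P : PlaceOver K F) {n : ℕ} (f : Fin n → F) :
    wronskian (tderiv K (P.uniformizer : F)) f ∈ P.ball (∑ j, P.ord (f j) - n.choose 2) :=
  P.det_mem_ball _ (fun j ↦ P.ord (f j)) fun i j ↦
    iterate_tderiv_uniformizer_mem_ball hrat P (f j) (i : ℕ)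

/-- **Change of variable in the Wronskian**: `W_z(f) = (dt_P/dz)^{n(n−1)/2} · W_{t_P}(f)` for a
non-constant `z` (`d/dz = (dt_P/dz) · d/dt_P`, chain rule). [cite: Zannier1993, Lemma 1] -/
theorem wronskian_tderiv_eq (hrat : ∀ P : PlaceOver K F, P.IsRational) {z : F}
    (hz : z ∉ Set.range (algebraMap K F)) (P : PlaceOver K F) {n : ℕ} (f : Fin n → F) :
    wronskian (tderiv K z) f =
      tderiv K z (P.uniformizer : F) ^ (n.choose 2) * wronskian (tderiv K (P.uniformizer : F)) f := by
  have hfun : (tderiv K z : F → F) =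
      fun y ↦ tderiv K z (P.uniformizer : F) * (tderivation K (P.uniformizer : F)) y := by
    funext y
    rw [tderivation_apply, mul_comm]
    exact tderiv_eq_tderiv_mul_tderiv (dOf_ne_zero hrat hz)
      (dOf_ne_zero hrat P.uniformizer_not_mem_range) y
  calc wronskian (tderiv K z) f
      = wronskian (fun y ↦ tderiv K z (P.uniformizer : F) * (tderivation K (P.uniformizer : F)) y) f :=
        congrArg (fun D : F → F ↦ wronskian D f) hfun
    _ = tderiv K z (P.uniformizer : F) ^ (n.choose 2) *
          wronskian (⇑(tderivation K (P.uniformizer : F))) f := wronskian_smul _ _ f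
    _ = _ := rfl

/-- **The order of `W_z` at a place** (Zannier's Lemma 1 rewritten): if `W_z(f) ≠ 0` then
`W_{t_P}(f) ≠ 0` and `v_P(W_z(f)) = −C(n,2) · v(dz/dt_P) + v_P(W_{t_P}(f))`, where
`v(dz/dt_P) = diffOrd_P(z)`. [cite: Zannier1993, Lemma 1] -/
theorem ord_wronskian_tderiv (hrat : ∀ P : PlaceOver K F, P.IsRational) {z : F}
    (hz : z ∉ Set.range (algebraMap K F)) (P : PlaceOver K F) {n : ℕ} (f : Fin n → F)
    (hW : wronskian (tderiv K z) f ≠ 0) :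
    wronskian (tderiv K (P.uniformizer : F)) f ≠ 0 ∧
      P.ord (wronskian (tderiv K z) f) =
        -((n.choose 2 : ℕ) : ℤ) * P.diffOrd z + P.ord (wronskian (tderiv K (P.uniformizer : F)) f) := by
  have hu := ord_tderiv hrat hz P.uniformizer_not_mem_range P
  rw [P.diffOrd_uniformizer, zero_sub] at hu
  have hu0 : tderiv K z (P.uniformizer : F) ≠ 0 := tderiv_ne_zero hrat hz P.uniformizer_not_mem_range
  rw [wronskian_tderiv_eq hrat hz P f] at hW ⊢
  have hW' : wronskian (tderiv K (P.uniformizer : F)) f ≠ 0 := right_ne_zero_of_mul hW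
  refine ⟨hW', ?_⟩
  rw [P.ord_mul_eq (pow_ne_zero _ hu0) hW', P.ord_pow hu0, hu]
  ring

omit [IsIntegrallyClosedIn K F] [CharZero K] in
/-- With all places rational, `Σ_{v ∈ T} v(x) = deg (x) = 0` for any finite `T` containing the zeros
and poles of `x ≠ 0` (Stichtenoth Thm. 1.4.11; Zannier 1993 (8), `Σ_v v(W) = 0`, and "since the `aᵢ` are
`S`-units we have `Σ_{v∈S} v(aᵢ) = 0`"). [cite: Stichtenoth2009, Thm. 1.4.11] -/
theorem sum_ord_eq_zero_of_forall_not_mem (hrat : ∀ P : PlaceOver K F, P.IsRational) {x : F}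
    (hx : x ≠ 0) (T : Finset (PlaceOver K F)) (hT : ∀ v : PlaceOver K F, v ∉ T → v.ord x = 0) :
    ∑ v ∈ T, v.ord x = 0 := by
  have h := degree_principalDivisor_eq_zero (K := K) hx
  rw [Divisor.degree_eq_finsum hrat, finsum_eq_sum_of_support_subset _ (s := T)] at h
  · simpa only [principalDivisor_apply_of_ne_zero hx] using h
  · intro v hv
    by_contra hvT
    exact hv (by rw [principalDivisor_apply_of_ne_zero hx, hT v hvT])

/-! ### Theorem 1 in the case `μ = n` -/

omit [IsIntegrallyClosedIn K F] [CharZero K] in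
/-- Sum of a function over `Fin n` after updating one value. [folklore] -/
theorem sum_update_eq {n : ℕ} (g : Fin n → ℤ) (h : Fin n) (x : ℤ) :
    ∑ j, Function.update g h x j = ∑ j, g j - g h + x := by
  rw [Finset.sum_update_of_mem (Finset.mem_univ h), ← Finset.sum_erase_add _ _ (Finset.mem_univ h),
    Finset.sdiff_singleton_eq_erase]
  ring

/-- **Zannier 1993, Theorem 1, case `μ = n`** (pp. 89–90, "following [3]" = Brownawell–Masser 1986).
Let `F/K` be a function field of one variable of genus `g`, `char K = 0`, `K` the full constant field and
all places rational; `S` a finite set of places; `a₁, …, aₙ` (`n ≥ 1`) `S`-units **linearly independent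
over `K`**; `b = a₁ + … + aₙ`. Then `Σ_{v∈S} (v(b) − min_i v(aᵢ)) ≤ C(n,2) (#S + 2g − 2)`.
Proof as printed: `W = W_z(a₁,…,aₙ) ≠ 0`; at `v ∈ S` with `v(a_h)` minimal, (5) `W = W(a₁,…,b,…,aₙ)` and
Lemma 1 (`ν = 0`) give `v(W) + C(n,2) v(dz/dt_v) + C(n,2) ≥ Σ v(aᵢ) + (v(b) − min v(aᵢ))`; sum over `S`
using `Σ_{v∈S} v(aᵢ) = 0` (6); off `S`, Lemma 1 (`ν = n`) gives `v(W) + C(n,2) v(dz/dt_v) ≥ 0` (7); and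
`Σ_v v(W) = 0`, `Σ_v v(dz/dt_v) = 2g − 2` (8). [cite: Zannier1993, Theorem 1 (case μ = n), pp. 89–90] -/
theorem Zannier1993_sum_le_of_linearIndependent (hrat : ∀ P : PlaceOver K F, P.IsRational)
    (S : Finset (PlaceOver K F)) {n : ℕ} (hn : 0 < n) (a : Fin n → F) (hind : LinearIndependent K a)
    (hS : ∀ (v : PlaceOver K F) (i : Fin n), v ∉ S → v.ord (a i) = 0) :
    ∑ v ∈ S, (v.ord (∑ i, a i) - ⨅ i, v.ord (a i)) ≤
      (n.choose 2 : ℤ) * ((S.card : ℤ) + (2 * (genus K F : ℤ) - 2)) := by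
  haveI : Nonempty (Fin n) := ⟨⟨0, hn⟩⟩
  have ha0 : ∀ i, a i ≠ 0 := fun i ↦ hind.ne_zero i
  set b := ∑ i, a i with hb
  -- a non-constant `z`
  obtain ⟨z, hz_tr⟩ := IsAlgFunctionField.exists_transcendental (K := K) (F := F)
  have hz : z ∉ Set.range (algebraMap K F) := by
    rintro ⟨c, rfl⟩
    exact hz_tr (isAlgebraic_algebraMap c)
  set D := tderivation K z with hD
  have hcoe : (⇑D : F → F) = tderiv K z := rfl
  set W := wronskian (tderiv K z) a with hW_def
  -- `W ≠ 0`: the `aᵢ` are linearly independent over the constants `K` of `d/dz`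
  have hW : W ≠ 0 := by
    have h := wronskian_ne_zero_of_forall_const_rel D a fun c hcD hcrel ↦ ?_
    · rwa [hcoe] at h
    have hc : ∀ j, c j ∈ Set.range (algebraMap K F) := fun j ↦
      (tderiv_eq_zero_iff hrat hz (c j)).1 (hcD j)
    choose c' hc' using hc
    have hsum : ∑ j, c' j • a j = 0 := by
      rw [← hcrel]
      exact Finset.sum_congr rfl fun j _ ↦ by rw [Algebra.smul_def, hc' j]
    have hc'0 := Fintype.linearIndependent_iff.1 hind c' hsum
    funext j
    rw [Pi.zero_apply, ← hc' j, hc'0 j, map_zero]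
  set C : ℤ := ((n.choose 2 : ℕ) : ℤ) with hC
  -- (7): `v(W) + C v(dz/dt_v) ≥ 0` wherever all `aᵢ` are integral, in particular off `S`
  have h7 : ∀ v : PlaceOver K F, (∀ i, a i ∈ v.toValuationSubring) →
      0 ≤ v.ord W + C * v.diffOrd z := by
    intro v hv
    obtain ⟨hWv, hordW⟩ := ord_wronskian_tderiv hrat hz v a hW
    have hmem := wronskian_tderiv_uniformizer_mem hrat v a hv
    have h0 := (v.mem_toValuationSubring_iff_ord_nonneg hWv).1 hmem
    rw [hordW]
    linarith
  -- (6): at every place, `v(b) − min v(aᵢ) ≤ v(W) + C v(dz/dt_v) + C − Σᵢ v(aᵢ)`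
  have h6 : ∀ v : PlaceOver K F,
      v.ord b - ⨅ i, v.ord (a i) ≤ v.ord W + C * v.diffOrd z + C - ∑ i, v.ord (a i) := by
    intro v
    obtain ⟨h, hh⟩ := exists_eq_ciInf_of_finite (f := fun i ↦ v.ord (a i))
    set g := Function.update a h b with hg
    have hWg : wronskian (tderiv K z) g = W := by
      have := wronskian_update_sum D a h
      rwa [hcoe] at this
    obtain ⟨hWgv, hordWg⟩ := ord_wronskian_tderiv hrat hz v g (by rw [hWg]; exact hW)
    have hball := wronskian_tderiv_uniformizer_mem_ball hrat v g
    have hle := (v.mem_ball_iff_le_ord _ hWgv).1 hball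
    have hsum_g : ∑ j, v.ord (g j) = ∑ j, v.ord (a j) - v.ord (a h) + v.ord b := by
      have : (fun j ↦ v.ord (g j)) = Function.update (fun j ↦ v.ord (a j)) h (v.ord b) := by
        funext j
        by_cases hj : j = h
        · rw [hj, Function.update_self, hg, Function.update_self]
        · rw [Function.update_of_ne hj, hg, Function.update_of_ne hj]
      rw [this, sum_update_eq]
    rw [hWg] at hordWg
    have hmin : (⨅ i, v.ord (a i)) = v.ord (a h) := hh.symm
    rw [hmin]
    rw [hsum_g] at hle
    linarith
  -- sum (6) over `S`; `Σ_{v∈S} Σᵢ v(aᵢ) = 0`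
  have hunits : ∑ v ∈ S, ∑ i, v.ord (a i) = 0 := by
    rw [Finset.sum_comm]
    exact Finset.sum_eq_zero fun i _ ↦
      sum_ord_eq_zero_of_forall_not_mem hrat (ha0 i) S fun v hv ↦ hS v i hv
  have hS6 : ∑ v ∈ S, (v.ord b - ⨅ i, v.ord (a i)) ≤
      ∑ v ∈ S, (v.ord W + C * v.diffOrd z) + C * S.card := by
    calc ∑ v ∈ S, (v.ord b - ⨅ i, v.ord (a i))
        ≤ ∑ v ∈ S, (v.ord W + C * v.diffOrd z + C - ∑ i, v.ord (a i)) :=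
          Finset.sum_le_sum fun v _ ↦ h6 v
      _ = ∑ v ∈ S, (v.ord W + C * v.diffOrd z) + C * S.card - ∑ v ∈ S, ∑ i, v.ord (a i) := by
          rw [Finset.sum_sub_distrib, Finset.sum_add_distrib, Finset.sum_const, nsmul_eq_mul]
          ring
      _ = ∑ v ∈ S, (v.ord W + C * v.diffOrd z) + C * S.card := by rw [hunits, sub_zero]
  -- (7) + (8): `Σ_{v∈S} (v(W) + C v(dz/dt_v)) ≤ Σ_v (v(W) + C v(dz/dt_v)) = C (2g − 2)`
  have hglob : ∑ v ∈ S, (v.ord W + C * v.diffOrd z) ≤ C * (2 * (genus K F : ℤ) - 2) := by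
    have hfinW := finite_setOf_ord_ne_zero_of_ne_zero (K := K) hW
    have hfind := finite_setOf_diffOrd_ne_zero hrat hz
    set T := S ∪ hfinW.toFinset ∪ hfind.toFinset with hT
    have hST : S ⊆ T := Finset.subset_union_left.trans Finset.subset_union_left
    have hWT : ∀ v : PlaceOver K F, v ∉ T → v.ord W = 0 := by
      intro v hv
      by_contra h
      exact hv (Finset.mem_union_left _ (Finset.mem_union_right _ (hfinW.mem_toFinset.2 h)))
    have hdT : ∀ v : PlaceOver K F, v ∉ T → v.diffOrd z = 0 := by
      intro v hv
      by_contra h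
      exact hv (Finset.mem_union_right _ (hfind.mem_toFinset.2 h))
    have hsumW : ∑ v ∈ T, v.ord W = 0 := sum_ord_eq_zero_of_forall_not_mem hrat hW T hWT
    have hsumd : ∑ v ∈ T, v.diffOrd z = 2 * (genus K F : ℤ) - 2 := by
      rw [← finsum_diffOrd_eq hrat hz, finsum_eq_sum_of_support_subset _ (s := T)]
      intro v hv
      by_contra hvT
      exact hv (hdT v hvT)
    have hTsum : ∑ v ∈ T, (v.ord W + C * v.diffOrd z) = C * (2 * (genus K F : ℤ) - 2) := by
      rw [Finset.sum_add_distrib, hsumW, zero_add, ← Finset.mul_sum, hsumd]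
    rw [← hTsum]
    refine Finset.sum_le_sum_of_subset_of_nonneg hST fun v _ hvS ↦ h7 v fun i ↦ ?_
    exact v.mem_toValuationSubring_of_ord_nonneg (by rw [hS v i hvS])
  calc ∑ v ∈ S, (v.ord b - ⨅ i, v.ord (a i))
      ≤ ∑ v ∈ S, (v.ord W + C * v.diffOrd z) + C * S.card := hS6
    _ ≤ C * (2 * (genus K F : ℤ) - 2) + C * S.card := by linarith
    _ = (n.choose 2 : ℤ) * ((S.card : ℤ) + (2 * (genus K F : ℤ) - 2)) := by rw [hC]; ring

end wronskians

end Literature.NumberTheory.DiophantineGeometry.AlgFunctionField
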